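import Summits.AtomisticToContinuum.HydrodynamicLimit.Theses.TwoClocks
import Summits.AtomisticToContinuum.HydrodynamicLimit.Theorems.TwoClocksTransferActivityTailsTransferLeHitWeight
import Summits.AtomisticToContinuum.HydrodynamicLimit.Theorems.TwoClocksTransferActivityTailsCollisionSumMono
import Summits.AtomisticToContinuum.HydrodynamicLimit.Theorems.TwoClocksTransferActivityTailsWeightedCountAEMeasurable
import Summits.AtomisticToContinuum.HydrodynamicLimit.Theorems.TwoClocksTransferActivityTailsExpTailLayerCake
import Summits.AtomisticToContinuum.HydrodynamicLimit.Theorems.TwoClocksTransferActivityTailsMeanTailAverage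
import HarnessLib

/-!
# `TransferActivityTails` (stmt-AtomisticToContinuum-16624), line `IdeatorOneSketch`: the crux from ONE tagged
sphere's weighted-count Chernoff bound (sorry-free conditional reduction)

Helper file (`--supports stmt-AtomisticToContinuum-16624`, registered stub
`stub_transferActivityTails_of_taggedCountTailBound`) for the crux
`Summit.AtomisticToContinuum.HydrodynamicLimit.Theses.TwoClocks.TransferActivityTails` (route TwoClocks, rank 7):
the a-priori `L¹` tail bound `E_λ[(N+1)⁻¹ Σ_i a_i 𝟙{a_i > V}] ≤ ε` for the window TRANSFER activity
`a_i(s) = (σ/τ) Σ_{collisions of i in (s, s+w]} (‖v_i⁺ − v_i⁻‖ + |‖v_i⁺‖² − ‖v_i⁻‖²|/2)`, `w = τ (N+1)^{-1/3}`, under the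
true evolution from local Gibbs data (skeleton `Cruxes/TransferActivityTails/Lines/IdeatorOneSketch.lean`, idea card
`Cruxes/TransferActivityTails/Ideas/tagged-count-chernoff.md`).

This file makes the line's NET THEOREM durable: the crux follows from the single open stub
`TaggedCountTailBound` (the line's transfer target `C⁺`: an exponential upper tail, with rate constants chosen before
`τ`, of ONE tagged sphere's energy-marked impulse-truncated window collision count `W_i(s)` under the true pre-shock
law, at levels `x ≥ V₀ τ/σ`) — `stub_transferActivityTails_of_taggedCountTailBound` — through the intermediate rung
`WeightedCountActivityTails` (the crux's own `L¹`-tail statement for the scaled count `(σ/τ) W_i` of EACH sphere: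
`transferActivityTails_of_weightedCountActivityTails`, `weightedCountActivityTails_of_taggedCountTailBound`), so a
future prover may dock at either statement.  Every other ingredient is LANDED and imported: the per-record kinematics `transferWeight ≤ hitWeight` from momentum + energy conservation
(`…TransferLeHitWeight.stub_transferLeHitWeight`), monotonicity of window collision sums on the good set
(`…CollisionSumMono.stub_collisionSumMono`), a.e.-measurability of `W_i` under the local Gibbs law
(`…WeightedCountAEMeasurable.stub_weightedCountAEMeasurable`), the exponential-tail layer cake
(`…ExpTailLayerCake.stub_expTailLayerCake`) and the averaging step (`…MeanTailAverage.stub_meanTailAverage`).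

Proof: `σ₀ := min σ₀⁺ 1/2`, `V₀ := V₀⁺`; given `V ≥ V₀`, `ε > 0` put `K := C (V + σ/(cτ₀)) σ/(cV)`,
`τ₁ := max τ₀ (K/ε)`; for `τ ≥ τ₁`, `N ≥ N₀(τ)`, `s ∈ [0,t]`: on the good set (full local Gibbs measure)
`a_i 𝟙{a_i > V} ≤ (σ/τ) W_i 𝟙{W_i > Vτ/σ}`, and `(σ/τ) E[W_i 𝟙{W_i > Vτ/σ}] ≤ C (V + σ/(cτ)) e^{-cVτ/σ} ≤ K/τ ≤ ε`
(`e^{-x} ≤ 1/x`); average over `i`.  So whoever proves `TaggedCountTailBound` closes the crux with a three-line file.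

References: I. Gallagher, L. Saint-Raymond, B. Texier, *From Newton to Boltzmann* (2013) §1.1, §4; T. Bodineau,
I. Gallagher, L. Saint-Raymond, Invent. Math. 203 (2016) §4 (domination + pruning, the template for `C⁺`).
-/

noncomputable section

open MeasureTheory Set Filter Topology
open scoped ENNReal InnerProductSpace BigOperators

namespace Summit.AtomisticToContinuum.HydrodynamicLimit.Theorems.TransferActivityTailsReduction

open Literature.MathematicalPhysics.KineticTheory Literature.Analysis.FluidPDE
open Summit.AtomisticToContinuum.HydrodynamicLimit.Theorems.CollisionActivityTailsEndpointTails
  (Flow Cfg window tailFn tailFn_of_lt tailFn_of_le measurable_tailFn ae_mem_good_localGibbsLaw)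
open Summit.AtomisticToContinuum.HydrodynamicLimit.Theorems.TransferActivityTailsTransferLeHitWeight
  (transferWeight hitWeight stub_transferLeHitWeight)
open Summit.AtomisticToContinuum.HydrodynamicLimit.Theorems.TransferActivityTailsCollisionSumMono
  (stub_collisionSumMono)
open Summit.AtomisticToContinuum.HydrodynamicLimit.Theorems.TransferActivityTailsWeightedCountAEMeasurable
  (weightedCount stub_weightedCountAEMeasurable)
open Summit.AtomisticToContinuum.HydrodynamicLimit.Theorems.TransferActivityTailsExpTailLayerCake
  (stub_expTailLayerCake)
open Summit.AtomisticToContinuum.HydrodynamicLimit.Theorems.TransferActivityTailsMeanTailAverage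
  (stub_meanTailAverage)

/-! ## §1 The open stub `C⁺` (verbatim from the registered skeleton) -/

/-- **The transfer target `C⁺` — tagged weighted-count Chernoff bound** (registered OPEN stub
`stub_taggedCountTailBound` of line IdeatorOneSketch, crux TransferActivityTails (stmt-AtomisticToContinuum-16624) —
route-internal, NOT a cited fact and not claimed: no N-uniform tail bound for the tagged collision count under a
non-equilibrium hard-sphere law at fixed packing is in print).  In the crux's frame (continuous positive profiles,
`σ < σ₀`, classical hs-Euler solution on `[0, T)` tied to the data by the `t = 0` LLN, every flow family, `t < T`):
there are a level `V₀ > 0` and rate constants `c, C > 0`, chosen BEFORE `τ`, such that for `τ ≥ τ₀`, `N ≥ N₀(τ)`,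
`s ∈ [0, t]`, every tagged index `i` and every level `x ≥ V₀ τ/σ` the true law gives
`P(x ≤ W_i(s)) ≤ C e^{-c x}`, `W_i(s) = weightedCount (Φ N) τ s i` the energy-marked impulse-truncated window count. -/
def TaggedCountTailBound : Prop :=
  ∀ (a₀ θ₀ : T3 → ℝ) (u₀ : T3 → V3), Continuous a₀ → Continuous θ₀ → Continuous u₀ →
    (∀ x, 0 < a₀ x) → (∀ x, 0 < θ₀ x) → ∃ σ₀ : ℝ, 0 < σ₀ ∧ ∀ σ : ℝ, 0 < σ → σ < σ₀ →
    ∀ (T : ℝ) (ρ θ : ℝ → T3 → ℝ) (u : ℝ → T3 → V3), IsHardSphereEulerSolution σ T ρ u θ →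
    ∀ Φ : (N : ℕ) → Flow σ N,
    TendstoHydroFieldsAt (fun N => localGibbsLaw σ a₀ u₀ θ₀ N (Φ N)) Φ ρ u θ 0 →
    ∀ t ∈ Set.Ico 0 T, ∃ V₀ : ℝ, 0 < V₀ ∧ ∃ c : ℝ, 0 < c ∧ ∃ C : ℝ, 0 < C ∧
    ∃ τ₀ : ℝ, 0 < τ₀ ∧ ∀ τ : ℝ, τ₀ ≤ τ → ∃ N₀ : ℕ, ∀ N : ℕ, N₀ ≤ N → ∀ s ∈ Set.Icc 0 t,
    ∀ i : Fin (N + 1), ∀ x : ℝ, V₀ * τ / σ ≤ x →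
      localGibbsLaw σ a₀ u₀ θ₀ N (Φ N) {z | x ≤ weightedCount (Φ N) τ s i z} ≤
        ENNReal.ofReal (C * Real.exp (-(c * x)))

/-- **Intermediate rung — `L¹` tails of the scaled weighted count, per sphere** (route-internal statement of line
IdeatorOneSketch, crux TransferActivityTails (stmt-AtomisticToContinuum-16624); NOT a cited fact and not claimed).
The crux's own tail statement with the transfer activity `a_i` replaced by the scaled energy-marked impulse-truncated
count `b_i(s) = (σ/τ) W_i(s)` of EACH tagged sphere: `∃V₀ ∀V ≥ V₀ ∀ε ∃τ₀ ∀τ ≥ τ₀ ∃N₀ ∀N ≥ N₀ ∀s ≤ t ∀i: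
E_λ[b_i 𝟙{b_i > V}] ≤ ε`.  Weaker than `TaggedCountTailBound` (`weightedCountActivityTails_of_taggedCountTailBound`),
stronger than the crux (`transferActivityTails_of_weightedCountActivityTails`). -/
def WeightedCountActivityTails : Prop :=
  ∀ (a₀ θ₀ : T3 → ℝ) (u₀ : T3 → V3), Continuous a₀ → Continuous θ₀ → Continuous u₀ →
    (∀ x, 0 < a₀ x) → (∀ x, 0 < θ₀ x) → ∃ σ₀ : ℝ, 0 < σ₀ ∧ ∀ σ : ℝ, 0 < σ → σ < σ₀ →
    ∀ (T : ℝ) (ρ θ : ℝ → T3 → ℝ) (u : ℝ → T3 → V3), IsHardSphereEulerSolution σ T ρ u θ →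
    ∀ Φ : (N : ℕ) → Flow σ N,
    TendstoHydroFieldsAt (fun N => localGibbsLaw σ a₀ u₀ θ₀ N (Φ N)) Φ ρ u θ 0 →
    ∀ t ∈ Set.Ico 0 T, ∃ V₀ : ℝ, 0 < V₀ ∧ ∀ V : ℝ, V₀ ≤ V → ∀ ε : ℝ, 0 < ε → ∃ τ₀ : ℝ, 0 < τ₀ ∧
    ∀ τ : ℝ, τ₀ ≤ τ → ∃ N₀ : ℕ, ∀ N : ℕ, N₀ ≤ N → ∀ s ∈ Set.Icc 0 t, ∀ i : Fin (N + 1),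
      ∫⁻ z, ENNReal.ofReal (tailFn V (σ / τ * weightedCount (Φ N) τ s i z))
        ∂(localGibbsLaw σ a₀ u₀ θ₀ N (Φ N)) ≤ ENNReal.ofReal ε

/-! ## §2 Pathwise domination of the crux's activity by the weighted count -/

variable {σ : ℝ} {N : ℕ}

/-- **`a_i ≤ (σ/τ) W_i` pathwise on the good set.**  For a good datum (honest finite window sums) the crux's window
transfer activity of particle `i` is at most `σ/τ` times its energy-marked impulse-truncated weighted count: the
per-record kinematics `transferWeight ≤ hitWeight` summed over the window's records. -/
theorem transferActivity_le_weightedCount (hσ : 0 ≤ σ) (Φ : Flow σ N) {z : Cfg N} (hz : z ∈ Φ.good) {τ : ℝ}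
    (hτ : 0 ≤ τ) (s : ℝ) (i : Fin (N + 1)) :
    σ / τ * Φ.collisionSum (Set.Ioc s (s + window τ N)) (transferWeight i) z ≤
      σ / τ * weightedCount Φ τ s i z :=
  mul_le_mul_of_nonneg_left
    (stub_collisionSumMono σ N Φ z hz s (s + window τ N) (transferWeight i) (hitWeight i)
      fun t k l => stub_transferLeHitWeight N (hsDiameter σ N) (Φ.flow t z) t i k l)
    (div_nonneg hσ hτ)

/-- The weighted count is nonnegative (every datum: a `finsum` of finite sums of nonnegative hit weights). -/
theorem weightedCount_nonneg (Φ : Flow σ N) (τ s : ℝ) (i : Fin (N + 1)) (z : Cfg N) :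
    0 ≤ weightedCount Φ τ s i z := by
  unfold weightedCount HardSphereFlow.collisionSum Literature.Analysis.FluidPDE.collisionSum
    Literature.Analysis.FluidPDE.collisionPairSum
  refine finsum_nonneg fun t => finsum_nonneg fun _ => Finset.sum_nonneg fun p _ => ?_
  dsimp only
  unfold TransferActivityTailsWeightedCountAEMeasurable.hitWeight
  split_ifs
  · positivity
  · exact le_rfl

/-! ## §3 The crux from the intermediate rung -/

/-- **The crux from the per-sphere `L¹` tails of the scaled weighted count.**  `σ₀ := min σ₀' 1/2` (a.e.-measurability
of `W_i` needs `σ < 1/2`), `V₀, τ₀, N₀` those of the rung; then for `N ≥ N₀`, `s ∈ [0,t]`, a.e. (good set, which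
carries the local Gibbs law) `a_i 𝟙{a_i > V} ≤ b_i 𝟙{b_i > V}` with `b_i = (σ/τ) W_i` (pathwise `a_i ≤ b_i` and
monotonicity of `y ↦ y 𝟙{y > V}`), each `E[b_i 𝟙{b_i > V}] ≤ ε` by the rung, and the empirical average of `N + 1`
such bounds is `≤ ε` (`stub_meanTailAverage`). -/
theorem transferActivityTails_of_weightedCountActivityTails (hW : WeightedCountActivityTails) :
    Summit.AtomisticToContinuum.HydrodynamicLimit.Theses.TwoClocks.TransferActivityTails := by
  intro a₀ θ₀ u₀ ha hθ hu ha0 hθ0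
  obtain ⟨σ₁, hσ₁, H⟩ := hW a₀ θ₀ u₀ ha hθ hu ha0 hθ0
  refine ⟨min σ₁ 2⁻¹, lt_min hσ₁ (by norm_num), ?_⟩
  intro σ hσ hσlt T ρ θ u hE Φ hlim t ht
  have hσ1 : σ < σ₁ := hσlt.trans_le (min_le_left _ _)
  have hσ2 : σ < 2⁻¹ := hσlt.trans_le (min_le_right _ _)
  obtain ⟨V₀, hV₀, HV⟩ := H σ hσ hσ1 T ρ θ u hE Φ hlim t ht
  refine ⟨V₀, hV₀, ?_⟩
  intro V hV ε hε
  have hVpos : 0 < V := hV₀.trans_le hV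
  obtain ⟨τ₀, hτ₀, Hτ⟩ := HV V hV ε hε
  refine ⟨τ₀, hτ₀, ?_⟩
  intro τ hτ
  have hτpos : 0 < τ := hτ₀.trans_le hτ
  obtain ⟨N₀, HN⟩ := Hτ τ hτ
  refine ⟨N₀, ?_⟩
  intro N hN s hs
  dsimp only
  set P := localGibbsLaw σ a₀ u₀ θ₀ N (Φ N) with hP
  have hκ : 0 ≤ σ / τ := div_nonneg hσ.le hτpos.le
  -- two facts about the tail functional `tailFn V y = 𝟙{V < y} y`
  have tailFn_nonneg' : ∀ y : ℝ, 0 ≤ tailFn V y := fun y =>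
    Set.indicator_nonneg (fun _ (h : _ < _) => hVpos.le.trans h.le) _
  have tailFn_mono' : ∀ {y y' : ℝ}, y ≤ y' → tailFn V y ≤ tailFn V y' := by
    intro y y' h
    by_cases hy : V < y
    · rw [tailFn_of_lt hy, tailFn_of_lt (hy.trans_le h)]
      exact h
    · rw [tailFn_of_le (not_lt.1 hy)]
      exact tailFn_nonneg' _
  -- the dominating functions `g i = tailFn V (b_i)`, `b_i = (σ/τ) W_i`
  set g : Fin (N + 1) → Cfg N → ℝ := fun i z => tailFn V (σ / τ * weightedCount (Φ N) τ s i z) with hg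
  have hg0 : ∀ i z, 0 ≤ g i z := fun i z => tailFn_nonneg' _
  have hgm : ∀ i, AEMeasurable (g i) P := fun i =>
    (measurable_tailFn V).comp_aemeasurable
      ((stub_weightedCountAEMeasurable σ hσ hσ2 a₀ θ₀ u₀ N (Φ N) τ s i).const_mul _)
  have hgi : ∀ i, ∫⁻ z, ENNReal.ofReal (g i z) ∂P ≤ ENNReal.ofReal ε := fun i => HN N hN s hs i
  -- pointwise a.e. domination of the crux integrand by the average of the `g i`
  have hgood : ∀ᵐ z ∂P, z ∈ (Φ N).good := ae_mem_good_localGibbsLaw σ a₀ θ₀ u₀ N (Φ N)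
  have hptw : ∀ᵐ z ∂P, ((N : ℝ) + 1)⁻¹ * ∑ i : Fin (N + 1),
      tailFn V (σ / τ * (Φ N).collisionSum (Set.Ioc s (s + window τ N)) (transferWeight i) z) ≤
      ((N : ℝ) + 1)⁻¹ * ∑ i : Fin (N + 1), g i z := by
    filter_upwards [hgood] with z hz
    refine mul_le_mul_of_nonneg_left (Finset.sum_le_sum fun i _ => ?_) (by positivity)
    exact tailFn_mono' (transferActivity_le_weightedCount hσ.le (Φ N) hz hτpos.le s i)
  calc ∫⁻ z, ENNReal.ofReal (((N : ℝ) + 1)⁻¹ * ∑ i : Fin (N + 1),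
          tailFn V (σ / τ * (Φ N).collisionSum (Set.Ioc s (s + window τ N)) (transferWeight i) z)) ∂P
      ≤ ∫⁻ z, ENNReal.ofReal (((N : ℝ) + 1)⁻¹ * ∑ i : Fin (N + 1), g i z) ∂P :=
        lintegral_mono_ae (hptw.mono fun z hz => ENNReal.ofReal_le_ofReal hz)
    _ ≤ ENNReal.ofReal ε := stub_meanTailAverage N P g (ENNReal.ofReal ε) hgm hg0 hgi

/-! ## §4 The intermediate rung from `C⁺` -/

/-- **The per-sphere `L¹` tails of the scaled count from the Chernoff bound `C⁺`.**  `σ₀ := min σ₀⁺ 1/2`;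
`V₀ := V₀⁺`; for `V ≥ V₀`, `ε > 0`: `K := C (V + σ/(cτ₀)) σ/(cV)`, `τ₁ := max τ₀ (K/ε)`; then for `τ ≥ τ₁`,
`N ≥ N₀(τ)`, `s ∈ [0,t]`, `i`: `E[b_i 𝟙{b_i > V}] = (σ/τ) E[W_i 𝟙{W_i > Vτ/σ}] ≤ (σ/τ) C (Vτ/σ + 1/c) e^{-cVτ/σ}`
(layer cake, `stub_expTailLayerCake`, with the a.e.-measurability `stub_weightedCountAEMeasurable`)
`= C (V + σ/(cτ)) e^{-cVτ/σ} ≤ K/τ ≤ ε` (`e^{-x} ≤ 1/x`). -/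
theorem weightedCountActivityTails_of_taggedCountTailBound (hC : TaggedCountTailBound) :
    WeightedCountActivityTails := by
  intro a₀ θ₀ u₀ ha hθ hu ha0 hθ0
  obtain ⟨σ₁, hσ₁, H⟩ := hC a₀ θ₀ u₀ ha hθ hu ha0 hθ0
  refine ⟨min σ₁ 2⁻¹, lt_min hσ₁ (by norm_num), ?_⟩
  intro σ hσ hσlt T ρ θ u hE Φ hlim t ht
  have hσ1 : σ < σ₁ := hσlt.trans_le (min_le_left _ _)
  have hσ2 : σ < 2⁻¹ := hσlt.trans_le (min_le_right _ _)
  obtain ⟨V₀, hV₀, c, hc, C, hC, τ₀, hτ₀, Hτ⟩ := H σ hσ hσ1 T ρ θ u hE Φ hlim t ht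
  refine ⟨V₀, hV₀, ?_⟩
  intro V hV ε hε
  have hVpos : 0 < V := hV₀.trans_le hV
  -- the constant `K` with `(σ/τ) C (Vτ/σ + 1/c) e^{-cVτ/σ} ≤ K / τ` for `τ ≥ τ₀`
  set K : ℝ := C * (V + σ / (c * τ₀)) * (σ / (c * V)) with hK
  have hK0 : 0 ≤ K := by positivity
  refine ⟨max τ₀ (K / ε), lt_max_of_lt_left hτ₀, ?_⟩
  intro τ hτ
  have hτ0 : τ₀ ≤ τ := (le_max_left _ _).trans hτ
  have hτK : K / ε ≤ τ := (le_max_right _ _).trans hτ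
  have hτpos : 0 < τ := hτ₀.trans_le hτ0
  obtain ⟨N₀, HN⟩ := Hτ τ hτ0
  refine ⟨N₀, ?_⟩
  intro N hN s hs i
  -- abbreviations
  set P := localGibbsLaw σ a₀ u₀ θ₀ N (Φ N) with hP
  set x₀ : ℝ := V * τ / σ with hx₀
  have hκ : 0 < σ / τ := div_pos hσ hτpos
  have hx₀pos : 0 < x₀ := by positivity
  have hVκ : V / (σ / τ) = x₀ := by
    rw [hx₀]
    field_simp
  -- scaling of the tail functional: `tailFn V ((σ/τ) y) = (σ/τ) tailFn (Vτ/σ) y`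
  have tailFn_scale : ∀ y : ℝ, tailFn V (σ / τ * y) = σ / τ * tailFn x₀ y := by
    intro y
    rw [← hVκ]
    by_cases hy : V / (σ / τ) < y
    · have h : V < σ / τ * y := by rwa [div_lt_iff₀' hκ] at hy
      rw [tailFn_of_lt hy, tailFn_of_lt h]
    · have h : σ / τ * y ≤ V := by
        have := not_lt.1 hy
        rwa [le_div_iff₀' hκ] at this
      rw [tailFn_of_le (not_lt.1 hy), tailFn_of_le h, mul_zero]
  -- `e^{-x} ≤ 1/x` and the arithmetic `(σ/τ) C (x₀ + 1/c) e^{-c x₀} ≤ K/τ ≤ ε`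
  have hexp : Real.exp (-(c * x₀)) ≤ (c * x₀)⁻¹ := by
    have hcx : 0 < c * x₀ := by positivity
    rw [Real.exp_neg]
    exact inv_anti₀ hcx (by linarith [Real.add_one_le_exp (c * x₀)])
  have hbound : σ / τ * (C * (x₀ + c⁻¹) * Real.exp (-(c * x₀))) ≤ ε := by
    have hστ : σ / (c * τ) ≤ σ / (c * τ₀) := by
      apply div_le_div_of_nonneg_left hσ.le (by positivity)
      exact mul_le_mul_of_nonneg_left hτ0 hc.le
    have h1' : σ / τ * (C * (x₀ + c⁻¹)) = C * (V + σ / (c * τ)) := by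
      rw [hx₀]
      field_simp
    have h2' : σ / τ * (C * (x₀ + c⁻¹) * Real.exp (-(c * x₀))) ≤ C * (V + σ / (c * τ₀)) * (c * x₀)⁻¹ := by
      calc σ / τ * (C * (x₀ + c⁻¹) * Real.exp (-(c * x₀)))
          = (σ / τ * (C * (x₀ + c⁻¹))) * Real.exp (-(c * x₀)) := by ring
        _ ≤ (C * (V + σ / (c * τ₀))) * (c * x₀)⁻¹ := by
            rw [h1']
            apply mul_le_mul _ hexp (Real.exp_pos _).le (by positivity)
            exact mul_le_mul_of_nonneg_left (by linarith) hC.le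
    have h3' : C * (V + σ / (c * τ₀)) * (c * x₀)⁻¹ = K / τ := by
      rw [hK, hx₀]
      field_simp
    have h4' : K / τ ≤ ε := by
      rw [div_le_iff₀ hτpos]
      calc K = K / ε * ε := by field_simp
        _ ≤ τ * ε := mul_le_mul_of_nonneg_right hτK hε.le
        _ = ε * τ := mul_comm _ _
    linarith [h2', h3'.le, h3'.ge]
  -- the tail hypothesis at levels `x ≥ x₀ ≥ V₀ τ/σ` and the layer cake
  have htail : ∀ x : ℝ, x₀ ≤ x → P {z | x ≤ weightedCount (Φ N) τ s i z} ≤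
      ENNReal.ofReal (C * Real.exp (-(c * x))) := by
    intro x hx
    refine HN N hN s hs i x (le_trans ?_ hx)
    rw [hx₀]
    exact div_le_div_of_nonneg_right (mul_le_mul_of_nonneg_right hV hτpos.le) hσ.le
  have hL := stub_expTailLayerCake N P (weightedCount (Φ N) τ s i)
    (stub_weightedCountAEMeasurable σ hσ hσ2 a₀ θ₀ u₀ N (Φ N) τ s i) (weightedCount_nonneg (Φ N) τ s i)
    x₀ c C hx₀pos hc hC.le htail
  calc ∫⁻ z, ENNReal.ofReal (tailFn V (σ / τ * weightedCount (Φ N) τ s i z)) ∂P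
      = ∫⁻ z, ENNReal.ofReal (σ / τ) * ENNReal.ofReal (tailFn x₀ (weightedCount (Φ N) τ s i z)) ∂P := by
        refine lintegral_congr fun z => ?_
        rw [tailFn_scale, ENNReal.ofReal_mul hκ.le]
    _ = ENNReal.ofReal (σ / τ) * ∫⁻ z, ENNReal.ofReal (tailFn x₀ (weightedCount (Φ N) τ s i z)) ∂P :=
        lintegral_const_mul' _ _ ENNReal.ofReal_ne_top
    _ ≤ ENNReal.ofReal (σ / τ) * ENNReal.ofReal (C * (x₀ + c⁻¹) * Real.exp (-(c * x₀))) := by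
        gcongr
    _ = ENNReal.ofReal (σ / τ * (C * (x₀ + c⁻¹) * Real.exp (-(c * x₀)))) :=
        (ENNReal.ofReal_mul hκ.le).symm
    _ ≤ ENNReal.ofReal ε := ENNReal.ofReal_le_ofReal hbound

/-! ## §5 The registered reduction stub: the crux from `C⁺` -/

/-- **The crux from the tagged weighted-count Chernoff bound** (registered stub
`stub_transferActivityTails_of_taggedCountTailBound` of line IdeatorOneSketch, crux TransferActivityTails
(stmt-AtomisticToContinuum-16624); sorry-free; conditional only on the displayed antecedent, the line's single open
stub `C⁺`): compose §4 and §3. -/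
theorem stub_transferActivityTails_of_taggedCountTailBound : TaggedCountTailBound → Summit.AtomisticToContinuum.HydrodynamicLimit.Theses.TwoClocks.TransferActivityTails :=
  fun h => transferActivityTails_of_weightedCountActivityTails (weightedCountActivityTails_of_taggedCountTailBound h)

end Summit.AtomisticToContinuum.HydrodynamicLimit.Theorems.TransferActivityTailsReduction

end
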